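import Summits.BirchSwinnertonDyer.BirchSwinnertonDyer.Theorems.AlignedTransportAtTwoBSDOfMainConjectureRankOneAtTwoEulerCharAtTwoKerGCell
import Summits.BirchSwinnertonDyer.Rank1Residual.Additive.LocalTowerKernelCardEqTamagawa
import Literature.NumberTheory.EllipticCurves.Greenberg1999.LocalH1DivisibleCyclotomicProofs
import Literature.NumberTheory.EllipticCurves.TamagawaSubgroupProofs
import Literature.NumberTheory.EllipticCurves.TamagawaFiniteIndexProofs
import Literature.NumberTheory.EllipticCurves.LFunctionPrimeCoeff
import Literature.NumberTheory.EllipticCurves.BSDQuadraticDescentTorsionOddPartProofs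
import Summits.BirchSwinnertonDyer.Rank1Residual.X2.TrivialZeroQuotient
import Summits.BirchSwinnertonDyer.Rank1Residual.Additive.QuadraticBranchOddStrictExactControlDischarge
import Mathlib.NumberTheory.Padics.HeightOneSpectrum
import HarnessLib

/-!
# Route `AlignedTransportAtTwo`, crux C3′ `BSDOfMainConjectureRankOneAtTwo` (stmt-BirchSwinnertonDyer-23008), line `birth`,
# the (L) road: the LOCAL ORDERS `∏_{v∈S} #𝒦_{v,0}[p^∞]` — the places `v ∤ p` EVALUATED (`p^{v_p(∏ c_v)}`, tree theorem), the place
# `v ∣ p` left as Greenberg's Lemma 3.4 (named PRINT fact); hence the open stub ⟺ (H) modulo the two NAMED facts Prop. 4.14 and Lemma 3.4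

HONEST FRAMING (cell `bsd-f1-sign2`, attach seat `bsd-line-att-p3` g12 under the C3′ lead lineage `bsd-line-att-p1`;
`--supports stmt-BirchSwinnertonDyer-23008 --as helper`). BSD is NOT proved; C3′ is NOT closed; nothing is asserted. THEOREMS
ONLY (no `def`, no named fact, no `sorry`). Successor of `…KerGCell` (same seat): there the local orders entered as an ad-hoc
hypothesis `hloc : ∏_{v∈S} #𝒦_{v,0}[2^∞] = 2^{v₂(∏ c_v)} · #Ẽ(𝔽₂)(2)²`; here `hloc` is DERIVED from the tree theorem
`Rank1Residual.Additive.natCard_localTowerKerPrimary_zero_eq_pow_padicValNat_localTamagawaNumber` (Greenberg's Lemma 3.3 VALUE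
`#𝒦_{v,0}[p^∞] = p^{ord_p c_v}` at every non-split `v ∤ p`; no finite place splits in the cyclotomic tower,
`Greenberg1999.exists_apply_resGal_ne_one_of_isCyclotomic`) plus Tamagawa bookkeeping (`tamagawaProduct = ∏ᶠ_v c_v`, `c_v = 1` at good
`v`), and the ONE remaining local input, Greenberg's Lemma 3.4 at the place over `p` (`#𝒦_{v_p,0}[p^∞] = #Ẽ(𝔽_p)(p)²`), by NAME
(`Greenberg1999.lemma34_natCard_localTowerKerPrimary_eq_rat`, PRINT at every `p`; at `2` every good ordinary curve is anomalous).

* §1 (every number field `K : Type`, every `p`, CYCLOTOMIC `κ`, `S ⊇ {v ∣ p} ∪ {bad}`, good reduction above `p`):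
  `prod_natCard_localTowerKerPrimary_eq_prod_filter_mul_pow` —
  **`∏_{v∈S} #𝒦_{v,0}[p^∞] = (∏_{v∈S, v∣p} #𝒦_{v,0}[p^∞]) · p^{v_p(∏_v c_v)}`**.
* §2 (`K = ℚ`): the place over `p` is unique (tree `X2.TrivialZeroQuotient.eq_of_natCast_mem`), so
  `prod_natCard_localTowerKerPrimary_eq_mul_pow_rat`: **`∏_{v∈S} #𝒦_{v,0}[p^∞] = #𝒦_{v_p,0}[p^∞] · p^{v_p(∏ c_v)}`**; and
  `prod_natCard_localTowerKerPrimary_eq_localOrders_of_lemma34`: modulo Lemma 3.4 (named fact) the product is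
  `p^{v_p(∏ c_v)} · #Ẽ(𝔽_p)(p)²` — the value `hloc` of `…KerGCell` at `p = 2`.
* §3 `schneiderLeadingTermFormulaAtTwoSqAt_iff_heightIndexAt_of_prop414_of_lemma34` — **THE OPEN STUB OF C3′ AT A CELL CURVE ⟺ THE
  HEIGHT-INDEX IDENTITY (H)** (`Finite θ.ker ∧ #coker θ = 1 ∧ #ker θ · (log₂5)^r = u · Reg₂(Dh) · i_S`, `i_S = ∏#𝒦/#(A₀/Sel₀)` = the
  Cassels–Poitou–Tate index), CONDITIONAL on exactly the two NAMED PRINT facts of the line: Greenberg Prop. 4.14 at `2` (`h414`) and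
  Greenberg Lemma 3.4 (`h34`).

References: [GreenbergLNM1716] §3 Lemmas 3.3–3.4 (pp. 86–89), §4 p. 74, Lemma 4.7, Prop. 4.14; [SilvermanAEC2009] VII.6 (Tamagawa numbers),
Cor. VII.6.2; [HachimoriMatsuno2000] Cor. (i); [PerrinRiou1992] §3.4.
bears_on: stmt-BirchSwinnertonDyer-23008 (helper; closes nothing), stmt-BirchSwinnertonDyer-22298 (attach seat's item; untouched).
-/

set_option autoImplicit false
-- the Theorems namespace of this sub repeats the summit name by design (D-0017 nested layout)
set_option linter.dupNamespace false

noncomputable section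

open scoped Classical NumberField

open CategoryTheory Field NumberField IsDedekindDomain Function WeierstrassCurve
open Literature.NumberTheory.EllipticCurves Literature.NumberTheory.EllipticCurves.GreenbergSelmer
open Literature.NumberTheory.GaloisRepresentations
open Literature.NumberTheory.GaloisCohomology
open scoped ContRepresentation

namespace Summit.BirchSwinnertonDyer.BirchSwinnertonDyer.Theorems.AlignedTransportAtTwoEulerCharAtTwoKerGLocalOrders

open Summit.BirchSwinnertonDyer.BirchSwinnertonDyer.Theorems.AlignedTransportAtTwoEulerCharAtTwoKerGCell
open Summit.BirchSwinnertonDyer.BirchSwinnertonDyer.Theorems.AlignedTransportAtTwoEulerCharAtTwoAssemblyKummer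
open Summit.BirchSwinnertonDyer.BirchSwinnertonDyer.Theorems.AlignedTransportAtTwoEulerCharAtTwoAssemblyDivisible
open ZpExtension Literature.NumberTheory.EllipticCurves.IwasawaAlgebra Literature.NumberTheory.EllipticCurves.IwasawaDual
open Literature.NumberTheory.EllipticCurves.Greenberg1999 Rat.HeightOneSpectrum

/-! ## §1 The places `v ∤ p`: Greenberg's Lemma 3.3 value and Tamagawa bookkeeping (every number field) -/

section AwayFromP

variable {K : Type} [Field K] [NumberField K] (W : WeierstrassCurve K) [W.IsElliptic] (p : ℕ) [hp : Fact p.Prime]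
  (κ : ZpExtension K p)

/-- **Greenberg's Lemma 3.3 VALUE in the cyclotomic tower**: for the CYCLOTOMIC `ℤ_p`-extension and `v ∤ p`,
`#𝒦_{v,0}[p^∞] = p ^ ord_p c_v` (the tree's exact count at a non-split `v ∤ p`; no finite place splits completely in the cyclotomic
`ℤ_p`-extension). [cite: GreenbergLNM1716, §3 Lemma 3.3 (pp. 86–88) and §4 proof of Thm. 4.1 (p. 74)] -/
theorem natCard_localTowerKerPrimary_zero_eq_pow_of_isCyclotomic (hκ : κ.IsCyclotomic) {v : HeightOneSpectrum (𝓞 K)}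
    (hpv : ((p : ℕ) : 𝓞 K) ∉ v.asIdeal) :
    Nat.card (W.localTowerKerPrimary κ (v.adicCompletion K) 0) =
      p ^ padicValNat p ((W.baseChange (v.adicCompletion K)).localTamagawaNumber (v.adicCompletionIntegers K)) := by
  obtain ⟨σ, hσ⟩ := exists_apply_resGal_ne_one_of_isCyclotomic hκ v
  exact Summit.BirchSwinnertonDyer.Rank1Residual.Additive.natCard_localTowerKerPrimary_zero_eq_pow_padicValNat_localTamagawaNumber
    W κ hpv ⟨σ, fun h ↦ hσ (ZpExtension.mem_kerSubgroup.mp h)⟩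

/-- **THE LOCAL ORDERS AWAY FROM `p`** (every number field, CYCLOTOMIC `κ`): for `S` a finite set of finite places off which `E` has good
reduction and `v ∤ p`, and good reduction at the places above `p`,
**`∏_{v∈S} #𝒦_{v,0}[p^∞] = (∏_{v∈S, p∈v} #𝒦_{v,0}[p^∞]) · p^{v_p(∏_v c_v)}`** — the factors at `v ∤ p` are `p^{ord_p c_v}` (Lemma 3.3
value) and `∏_{v∈S, v∤p} c_v` is the whole Tamagawa product (`c_v = 1` at good `v`).
[cite: GreenbergLNM1716, §3 Lemma 3.3, §4 proof of Thm. 4.1 (p. 74)] [cite: SilvermanAEC2009, VII.6, Cor. VII.6.2] -/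
theorem prod_natCard_localTowerKerPrimary_eq_prod_filter_mul_pow (hκ : κ.IsCyclotomic)
    (S : Finset (HeightOneSpectrum (𝓞 K))) (hS : ∀ v ∉ S, ((p : ℕ) : 𝓞 K) ∉ v.asIdeal ∧ W.HasGoodReductionAt v)
    (hgoodp : ∀ v : HeightOneSpectrum (𝓞 K), ((p : ℕ) : 𝓞 K) ∈ v.asIdeal → W.HasGoodReductionAt v) :
    ∏ v ∈ S, Nat.card (W.localTowerKerPrimary κ (v.adicCompletion K) 0) =
      (∏ v ∈ S.filter (fun v ↦ ((p : ℕ) : 𝓞 K) ∈ v.asIdeal), Nat.card (W.localTowerKerPrimary κ (v.adicCompletion K) 0)) *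
        p ^ padicValNat p W.tamagawaProduct := by
  classical
  -- notation for the local Tamagawa numbers
  set c : HeightOneSpectrum (𝓞 K) → ℕ := fun v ↦
    (W.baseChange (v.adicCompletion K)).localTamagawaNumber (v.adicCompletionIntegers K) with hc
  have hc0 : ∀ v, c v ≠ 0 := fun v ↦ W.localTamagawaNumber_baseChange_ne_zero v
  have hc1 : ∀ v, W.HasGoodReductionAt v → c v = 1 := fun v hv ↦ W.localTamagawaNumber_eq_one_of_hasGoodReductionAt_holds v hv
  rw [← Finset.prod_filter_mul_prod_filter_not S (fun v ↦ ((p : ℕ) : 𝓞 K) ∈ v.asIdeal)]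
  congr 1
  -- the places `v ∤ p` of `S`
  set T := S.filter (fun v ↦ ((p : ℕ) : 𝓞 K) ∉ v.asIdeal) with hT
  have hTval : ∀ v ∈ T, Nat.card (W.localTowerKerPrimary κ (v.adicCompletion K) 0) = p ^ padicValNat p (c v) := fun v hv ↦
    natCard_localTowerKerPrimary_zero_eq_pow_of_isCyclotomic W p κ hκ (Finset.mem_filter.mp hv).2
  rw [Finset.prod_congr rfl hTval, Finset.prod_pow_eq_pow_sum,
    ← Summit.BirchSwinnertonDyer.Rank1Residual.Additive.LevelBridge.padicValNat_finset_prod' p T c (fun v _ ↦ hc0 v)]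
  congr 2
  -- `∏_{v ∈ T} c_v = ∏ᶠ_v c_v`
  symm
  apply finprod_eq_prod_of_mulSupport_subset
  intro v hv
  rw [Function.mem_mulSupport] at hv
  rw [Finset.mem_coe, hT, Finset.mem_filter]
  by_cases hvS : v ∈ S
  · exact ⟨hvS, fun hpv ↦ hv (hc1 v (hgoodp v hpv))⟩
  · exact absurd (hc1 v (hS v hvS).2) hv

end AwayFromP

/-! ## §2 `K = ℚ`: one place over `p`; the local orders modulo Lemma 3.4 -/

section Rat

variable (W : WeierstrassCurve ℚ) [W.IsElliptic] [W.IsGloballyMinimal] (p : ℕ) [hp : Fact p.Prime]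

omit [W.IsElliptic] [W.IsGloballyMinimal] in
/-- The place of `ℚ` above `p` contains `p`. [folklore] -/
theorem natCast_mem_asIdeal_primesEquiv_symm :
    ((p : ℕ) : 𝓞 ℚ) ∈ (primesEquiv.symm ⟨p, hp.out⟩ : HeightOneSpectrum (𝓞 ℚ)).asIdeal := by
  set v : HeightOneSpectrum (𝓞 ℚ) := primesEquiv.symm ⟨p, hp.out⟩ with hvdef
  have hv : natGenerator v = p := by
    change ((primesEquiv v : Nat.Primes) : ℕ) = p
    rw [hvdef, Equiv.apply_symm_apply]
  have h1 : natGenerator v ∣ p := by rw [hv]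
  rw [natGenerator_dvd_iff] at h1
  rw [← Ideal.apply_mem_of_equiv_iff (f := Rat.IsIntegralClosure.intEquiv (𝓞 ℚ)), map_natCast]
  exact h1

omit [W.IsGloballyMinimal] in
/-- **`K = ℚ`: `∏_{v∈S} #𝒦_{v,0}[p^∞] = #𝒦_{v_p,0}[p^∞] · p^{v_p(∏ c_v)}`** for `W/ℚ` with good reduction at `p`, the cyclotomic
`ℤ_p`-extension, `S ⊇ {p} ∪ {bad}` and `v_p` the place over `p`. [cite: GreenbergLNM1716, §3 Lemma 3.3, §4 proof of Thm. 4.1 (p. 74)] -/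
theorem prod_natCard_localTowerKerPrimary_eq_mul_pow_rat (hgood : W.HasGoodReductionAtPrime p)
    (κ : ZpExtension ℚ p) (hκ : κ.IsCyclotomic)
    (S : Finset (HeightOneSpectrum (𝓞 ℚ))) (hS : ∀ v ∉ S, ((p : ℕ) : 𝓞 ℚ) ∉ v.asIdeal ∧ W.HasGoodReductionAt v)
    {v₀ : HeightOneSpectrum (𝓞 ℚ)} (hv₀ : ((p : ℕ) : 𝓞 ℚ) ∈ v₀.asIdeal) :
    ∏ v ∈ S, Nat.card (W.localTowerKerPrimary κ (v.adicCompletion ℚ) 0) =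
      Nat.card (W.localTowerKerPrimary κ (v₀.adicCompletion ℚ) 0) * p ^ padicValNat p W.tamagawaProduct := by
  classical
  have hgoodp : ∀ v : HeightOneSpectrum (𝓞 ℚ), ((p : ℕ) : 𝓞 ℚ) ∈ v.asIdeal → W.HasGoodReductionAt v := fun v hv ↦
    (hasGoodReductionAtPrime_primesEquiv_iff_holds W v p (primesEquiv_eq_of_natCast_mem v hp.out hv)).mp hgood
  have hv₀S : v₀ ∈ S := by
    by_contra h
    exact (hS v₀ h).1 hv₀
  have hfilter : S.filter (fun v ↦ ((p : ℕ) : 𝓞 ℚ) ∈ v.asIdeal) = {v₀} := by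
    ext v
    rw [Finset.mem_filter, Finset.mem_singleton]
    constructor
    · rintro ⟨-, hv⟩
      exact Summit.BirchSwinnertonDyer.Rank1Residual.X2.TrivialZeroQuotient.eq_of_natCast_mem p hv hv₀
    · rintro rfl
      exact ⟨hv₀S, hv₀⟩
  rw [prod_natCard_localTowerKerPrimary_eq_prod_filter_mul_pow W p κ hκ S hS hgoodp, hfilter, Finset.prod_singleton]

/-- **The local orders on the cell, modulo Greenberg's Lemma 3.4 (named PRINT fact)**: for `W/ℚ` globally minimal with `IsOrdinaryAt W p`,
the cyclotomic `κ` and `S ⊇ {p} ∪ {bad}`: **`∏_{v∈S} #𝒦_{v,0}[p^∞] = p^{v_p(∏ c_v)} · #Ẽ(𝔽_p)(p)²`** — the `v ∤ p` factors by §1 (tree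
theorems), the factor at `p` by Lemma 3.4 at layer `0` (`#𝒦_{v_p,0}[p^∞] = (p^{ord_p #Ẽ(𝔽_p)})² = #Ẽ(𝔽_p)(p)²`). At `p = 2` this is the
hypothesis `hloc` of `…KerGCell.schneiderLeadingTermFormulaAtTwoSqAt_iff_heightIndexAt_of_prop414_of_localOrders`.
[cite: GreenbergLNM1716, §3 Lemmas 3.3–3.4 (pp. 86–89), §4 Thm. 4.1 (p. 102)] -/
theorem prod_natCard_localTowerKerPrimary_eq_localOrders_of_lemma34 (h34 : lemma34_natCard_localTowerKerPrimary_eq_rat)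
    (hord : IsOrdinaryAt W p) (κ : ZpExtension ℚ p) (hκ : κ.IsCyclotomic)
    (S : Finset (HeightOneSpectrum (𝓞 ℚ))) (hS : ∀ v ∉ S, ((p : ℕ) : 𝓞 ℚ) ∉ v.asIdeal ∧ W.HasGoodReductionAt v) :
    ∏ v ∈ S, Nat.card (W.localTowerKerPrimary κ (v.adicCompletion ℚ) 0) =
      p ^ padicValNat p W.tamagawaProduct *
        Nat.card (AddCommGroup.primaryComponent
          ((integralModelInt W).map (Int.castRingHom (ZMod p))).toAffine.Point p) ^ 2 := by
  have hv₀ := natCast_mem_asIdeal_primesEquiv_symm p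
  rw [prod_natCard_localTowerKerPrimary_eq_mul_pow_rat W p hord.1 κ hκ S hS hv₀, (h34 W p hord κ hκ _ hv₀ 0).2,
    natCard_primaryComponent_eq_pow_padicValNat p, mul_comm]
  rfl

end Rat

/-! ## §3 The open stub of C3′ at a cell curve ⟺ (H), modulo the two NAMED PRINT facts Prop. 4.14 and Lemma 3.4 -/

section CellH

variable (W : WeierstrassCurve ℚ) [W.IsElliptic] [W.IsGloballyMinimal]

/-- **THE OPEN STUB OF C3′ AT A CELL CURVE ⟺ THE HEIGHT-INDEX IDENTITY (H), MODULO EXACTLY THE TWO NAMED PRINT FACTS OF THE LINE**: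
Greenberg Prop. 4.14 / Hachimori–Matsuno Cor. (i) (`h414 : prop414_noFiniteSubmodule_of_not_dvd_torsionOrder`) and Greenberg Lemma 3.4
(`h34 : lemma34_natCard_localTowerKerPrimary_eq_rat`), both published at every `p`, `2` included. For `W/ℚ` globally minimal,
`IsOrdinaryAt W 2`, `E(ℚ)[2] = 0`, `2 ∤ #E(ℚ)_tors`, `S ⊇ {2} ∪ {bad}`: `SchneiderLeadingTermFormulaAtTwoSqAt W` holds IFF for every
cyclotomic datum, every finitely generated torsion strict dual `D`, THE `Σ²` height `Dh` with `Reg₂(Dh) ≠ 0`, `Ш(E/ℚ)(2)` finite, and every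
`e`, `e₀`, `κ_M : M ↪ Sel_{2^∞}(E/ℚ)` (cokernel of order `#Ш(2)`), the derived Kummer map `θ` has finite kernel, TRIVIAL cokernel, and
**`#ker θ · (log₂5)^{rank E(ℚ)} = u · Reg₂(Dh) · i_S`**, `u ∈ ℤ₂ˣ`, `i_S = (∏_{v∈S} #𝒦_{v,0}[2^∞]) / #(A₀/Sel₀) = [E(ℚ) : E_𝒦]` the
Cassels–Poitou–Tate index (`…KerGCell.exists_level_kerIndexL_rat`, `natCard_quotient_eq_prod_div_natCard_kerG`). This is
`…KerGCell.schneiderLeadingTermFormulaAtTwoSqAt_iff_heightIndexAt_of_prop414_of_localOrders` with its ad-hoc `hloc` DERIVED (§2).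
READING: what is open of C3′ at a cell curve is (H) alone — «the Bockstein pairing of `θ` is the canonical `Σ²` height up to a `2`-adic
unit, with universal-norm index `[E(ℚ):E_𝒦]`» (Perrin-Riou 1992 §3.4 / Schneider 1985 for odd `p`; not in print at `2`). Closes nothing.
[cite: GreenbergLNM1716, §3 Lemmas 3.3–3.4, §4 Lemmas 4.2–4.7, Prop. 4.14] [cite: HachimoriMatsuno2000, Cor. (i)] [cite: PerrinRiou1992, §3.4] -/
theorem schneiderLeadingTermFormulaAtTwoSqAt_iff_heightIndexAt_of_prop414_of_lemma34
    (h414 : prop414_noFiniteSubmodule_of_not_dvd_torsionOrder) (h34 : lemma34_natCard_localTowerKerPrimary_eq_rat)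
    (hK : ∀ P : W.toAffine.Point, 2 • P = 0 → P = 0) (h2 : ¬ 2 ∣ W.torsionOrder) (hord : IsOrdinaryAt W 2)
    (S : Finset (HeightOneSpectrum (𝓞 ℚ))) (hS : ∀ v ∉ S, ((2 : ℕ) : 𝓞 ℚ) ∉ v.asIdeal ∧ W.HasGoodReductionAt v) :
    Summit.BirchSwinnertonDyer.Rank1Residual.F1Sign2.SchneiderLeadingTermFormulaAtTwoSqAt W ↔
    (∀ (κ : ZpExtension ℚ 2) (γ : Field.absoluteGaloisGroup ℚ),
        κ.IsCyclotomic → κ.IsTopGenerator γ → IsCyclotomicVariable 2 γ →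
      ∀ (D : W.SelmerDualData κ γ) [Module.Finite (IwasawaAlgebra 2) D.X], D.IsTorsion →
      ∀ (Dh : PAdicHeightData W 2), Dh.IsCanonicalSq →
        SchneiderConjecture Dh → Finite (AddCommGroup.primaryComponent W.sha 2) →
      ∀ (e : ↥(W.selmerInfty κ ⊓ W.layerInvariants κ 0) ≃+ ↥(endInvariants (W.conjSelmerInfty κ γ - 1)))
        (e₀ : ↥(W.selmerGroupPInfty 2) ≃+ ↥(W.selmerLayer κ 0))
        (M : Type) [AddCommGroup M] (kS : M →+ ↥(W.selmerGroupPInfty 2)), Function.Injective kS →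
        Nat.card (↥(W.selmerGroupPInfty 2) ⧸ kS.range) = Nat.card (AddCommGroup.primaryComponent W.sha 2) →
      ∀ (θ : M →+ EndCoinvariants (W.conjSelmerInfty κ γ - 1)),
        θ = (W.selmerInftyEulerMap κ γ).comp
          (((e : ↥(W.selmerInfty κ ⊓ W.layerInvariants κ 0) →+ ↥(endInvariants (W.conjSelmerInfty κ γ - 1))).comp (W.sMap κ 0)).comp
            ((e₀ : ↥(W.selmerGroupPInfty 2) →+ ↥(W.selmerLayer κ 0)).comp kS)) →
        Finite θ.ker ∧ Nat.card (EndCoinvariants (W.conjSelmerInfty κ γ - 1) ⧸ θ.range) = 1 ∧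
        ∃ u : ℤ_[2]ˣ,
          (Nat.card θ.ker : ℚ_[2]) * padicLog 2 (cyclotomicGenerator 2) ^ W.mordellWeilRank =
            ((u : ℤ_[2]) : ℚ_[2]) * padicRegulator Dh *
              (((∏ v ∈ S, Nat.card (W.localTowerKerPrimary κ (v.adicCompletion ℚ) 0)) / Nat.card (W.KerG κ 0) : ℕ) : ℚ_[2])) :=
  schneiderLeadingTermFormulaAtTwoSqAt_iff_heightIndexAt_of_prop414_of_localOrders W h414 hK h2 hord S hS
    (fun κ hκ ↦ prod_natCard_localTowerKerPrimary_eq_localOrders_of_lemma34 W 2 h34 hord κ hκ S hS)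

end CellH

end Summit.BirchSwinnertonDyer.BirchSwinnertonDyer.Theorems.AlignedTransportAtTwoEulerCharAtTwoKerGLocalOrders

end
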